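import Summits.ResolutionOfSingularities.ResolutionOfSingularities.Theorems.HilbertSamuelEliminationCampaignW42RidgeConfinesOfPermissible
import Literature.AlgebraicGeometry.Resolution.NearPointRidgeDietel
import Literature.AlgebraicGeometry.Resolution.PermissibleCentres
import Literature.AlgebraicGeometry.CossartJannsenSaito2020.KeyTheorems
import HarnessLib

/-!
# [OURS · L1 W4.2] Near points of the blow-up of a point with PERFECT residue field lie on the projectivised DIRECTRIX
# — unconditionally, every characteristic, no dimension hypothesis (campaign s42, cell res-hironaka; informal crux
# `RidgeConfinement`, stmt-ResolutionOfSingularities-17845, and the W-top confinement door of chain w42,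
# stmt-ResolutionOfSingularities-19249; `--supports`)

HONEST FRAMING. OURS (slot W4.2, prover res-L1-s42-pv-1, gen 3). Chain w42's W-top confinement door
(`…CampaignW42WtopConfinement.lean`: `isOnProjDirectrix_of_near_top`, D10) concludes
`CossartJannsenSaito2020.IsOnProjDirectrix π x'` MODULO the thesis-flagged named fact F-58♭
(`Dietel2015_mainTheoremC_point_locus`: `dim X ≤ 5 ∨ dim X + 1 ≤ 2 char`, point centre, ridge dimension kept). This
file proves the conclusion UNCONDITIONALLY at points `x` with PERFECT residue field `κ(x)` (e.g. closed points of a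
scheme of finite type over a perfect field), with no dimension / characteristic / ridge-dimension hypothesis:

* `mem_localRidge_of_isNearPoint_point` — for the blow-up of the (permissible) point `x` (`𝓘_{D,x} = 𝔪_x`) and a near
  point `x'` over `x`: the direction `ū = (x_i/x_{j}) (x') ∈ κ(x')^e` read in the tree's minimal generators
  `x = minGenerators 𝒪_{X,x}` and the tree's chart (`IsBlowup.exists_reesChart_stalk`) is a `κ(x')`-point of Giraud's
  ridge `F_x(X)` (`localRidge`) — from `ridgeConfinedAt_of_isNearRing_of_ringHom` (`…RidgeConfinesOfPermissible`) with
  the degree-one initial forms `X_i` of the `x_i`;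
* `aeval_eq_zero_of_mem_ridge_of_mem_radical` — a field-valued point of `V(𝔉)` is a point of `V(√𝔉)`;
* **`isOnProjDirectrix_of_isNearPoint_of_perfectField`** — if moreover `κ(x)` is PERFECT then `IsOnProjDirectrix π x'`:
  by Dietel (6.3.5) (ii) PROVED in the tree (`Dietel2015_ridge_perfect_holds`: `√𝔉 = 𝒯·S` over a perfect field) every
  linear form of the directrix space vanishes at `ū`, which is the membership `π♯(Σ c_i x_i) ∈ 𝔪_x𝒪' · 𝔪_{x'}`;
* **`isOnProjDirectrix_of_near_of_perfectField`** — the door's shape: `X` excellent, `x` closed with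
  `0 < dim 𝒪_{X,x}`, `π` the blow-up in `{x}`, `κ(x)` perfect, `x'` over `x` near at level `N`
  (`H^N_{X'}(x') = H^N_X(x)`) ⟹ `IsOnProjDirectrix π x'` — NO `Dietel2015_mainTheoremC_point_locus`, NO `NearAlignment`,
  NO `dim X ≤ 5`, NO `char > 0`, NO `ē` bookkeeping.

This is CJS Thm. 3.14 for point blow-ups at perfect-residue-field points in ALL characteristics (their proof needs
`char κ(x) = 0 ∨ ≥ dim X/2 + 1`; the imperfect case is genuinely false — Hironaka's quadric, tree barrier
`DirectrixSmallCharacteristic`). NOTHING here is a statement of H. Hironaka's manuscript [Hironaka2017]. AI review is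
weaker than expert review. References (orientation only): V. Cossart, U. Jannsen, S. Saito, LNM 2270 (2020), Thm. 3.14,
Def. 6.34; B. Dietel, Dissertation Regensburg (2015), Lemma (6.3.5) (ii), Main Theorem C; J. Giraud (1975) §1.5.
-/

noncomputable section

-- single-conjunct summit: the doubled namespace component `ResolutionOfSingularities` is mandated
set_option linter.dupNamespace false

open CategoryTheory AlgebraicGeometry IsLocalRing MvPolynomial
open Literature.RingTheory.HilbertSamuel Literature.RingTheory.MvPolynomial
open Literature.AlgebraicGeometry.Resolution Literature.AlgebraicGeometry.CossartJannsenSaito2020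

namespace Summit.ResolutionOfSingularities.ResolutionOfSingularities.Theorems

namespace CampaignW42

universe u

/-! ## Field-valued points of the ridge kill the radical of its ideal -/

/-- A point of `V(𝔉)` with values in a reduced ring (e.g. a field) is a point of `V(√𝔉)`. [folklore] -/
theorem aeval_eq_zero_of_mem_ridge_of_mem_radical {K : Type u} [Field K] {n : ℕ} {I : Ideal (MvPolynomial (Fin n) K)}
    {κ : Type u} [CommRing κ] [IsReduced κ] [Algebra K κ] {v : Fin n → κ} (hv : v ∈ ridge κ I)
    {g : MvPolynomial (Fin n) K} (hg : g ∈ (ridgeIdeal I).radical) : aeval v g = 0 := by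
  obtain ⟨m, hm⟩ := hg
  have h := mem_ridge_iff_forall_ridgeIdeal.mp hv _ hm
  rw [map_pow] at h
  exact IsReduced.eq_zero _ ⟨m, h⟩

/-- Abstract bookkeeping for `IsOnProjDirectrix`: if `φ(x_i) = u_i · t` with `t ∈ 𝔪_A B` and
`Σ_i φ̄(c̄_i) ū_i = 0` in the residue field of `B`, then `φ(Σ_i c_i x_i) ∈ 𝔪_A B · 𝔪_B`. [folklore] -/
theorem map_sum_mul_mem_of_residue_sum_eq_zero {A B : Type u} [CommRing A] [CommRing B] [IsLocalRing A]
    [IsLocalRing B] (φ : A →+* B) [IsLocalHom φ] {e : ℕ} (x c : Fin e → A) (u : Fin e → B) (t : B)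
    (hx : ∀ i, φ (x i) = u i * t) (ht : t ∈ (maximalIdeal A).map φ) (w : Fin e → ResidueField A)
    (hw : ∀ i, residue A (c i) = w i) (h0 : ∑ i, ResidueField.map φ (w i) * residue B (u i) = 0) :
    φ (∑ i, c i * x i) ∈ (maximalIdeal A).map φ * maximalIdeal B := by
  have hsum : φ (∑ i, c i * x i) = (∑ i, φ (c i) * u i) * t := by
    rw [map_sum, Finset.sum_mul]
    refine Finset.sum_congr rfl fun i _ => ?_
    rw [map_mul, hx i, mul_assoc]
  have hmem : ∑ i, φ (c i) * u i ∈ maximalIdeal B := by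
    rw [← residue_eq_zero_iff, map_sum, ← h0]
    refine Finset.sum_congr rfl fun i _ => ?_
    rw [map_mul, ← hw i, ResidueField.map_residue]
  rw [hsum]
  exact Ideal.mul_comm ((maximalIdeal A).map φ) (maximalIdeal B) ▸ Ideal.mul_mem_mul hmem ht

/-- `(Σ_i w_i X_i)(v) = Σ_i w_i v_i`. [folklore] -/
theorem aeval_linForm_eq_sum {K : Type u} [Field K] {n : ℕ} {κ : Type u} [CommRing κ] [Algebra K κ]
    (w : Fin n → K) (v : Fin n → κ) : aeval v (linForm w) = ∑ i, algebraMap K κ (w i) * v i := by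
  rw [linForm_apply, map_sum]
  refine Finset.sum_congr rfl fun i _ => ?_
  rw [map_smul, aeval_X, Algebra.smul_def]

/-! ## Point blow-ups: the direction is a point of the ridge -/

section Point

variable {X X' : Scheme.{u}} [IsLocallyNoetherian X] [IsLocallyNoetherian X'] {π : X' ⟶ X} {D : X.IdealSheafData}

omit [IsLocallyNoetherian X'] in
/-- **The direction of a near point of a point blow-up is a point of Giraud's ridge `F_x(X)`.** Let `π` be a blow-up
along `D` with `𝓘_{D,x} = 𝔪_x` at `x = π x'` (the point `x` is the centre near `x'`), `D` permissible at `x`,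
`𝒪_{X,x}` universally catenary, `x'` near at level `N`; let `χ : 𝒪_{X,x}[𝔪_x/x_j] → 𝒪_{X',x'}` be a chart through `x'`
(`IsBlowup.exists_reesChart_stalk` for the minimal generators `x`). Then `(χ(x_i/x_j) mod 𝔪_{x'})_i ∈ F(𝒪_{X,x})(κ(x'))`.
[cite: CossartJannsenSaito2020, Thm. 3.14] [cite: Giraud1975, Cor. 2.4] -/
theorem mem_localRidge_of_isNearPoint_point (x' : X')
    (hperm : IdealSheafData.IsPermissibleAt D (π.base x'))
    (hUC : IsUniversallyCatenaryRing (X.presheaf.stalk (π.base x')))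
    (hD : stalkIdeal D (π.base x') = maximalIdeal (X.presheaf.stalk (π.base x')))
    {N : ℕ} (hnear : IsNearPoint π N x')
    (j : Fin (maximalIdeal (X.presheaf.stalk (π.base x'))).spanFinrank)
    (𝔴 : PrimeSpectrum (chartRing (minGenerators (X.presheaf.stalk (π.base x'))) j))
    (χ : chartRing (minGenerators (X.presheaf.stalk (π.base x'))) j →+* X'.presheaf.stalk x')
    (hχ : ∀ a, χ (chartBase (minGenerators (X.presheaf.stalk (π.base x'))) j a) = (π.stalkMap x').hom a)
    (hloc : @IsLocalization.AtPrime _ _ (X'.presheaf.stalk x') _ χ.toAlgebra 𝔴.asIdeal _)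
    (h𝔴 : 𝔴.asIdeal.comap (chartBase (minGenerators (X.presheaf.stalk (π.base x'))) j) =
      maximalIdeal (X.presheaf.stalk (π.base x'))) :
    letI : Algebra (ResidueField (X.presheaf.stalk (π.base x'))) (ResidueField (X'.presheaf.stalk x')) :=
      (ResidueField.map (π.stalkMap x').hom).toAlgebra
    (fun i => residue (X'.presheaf.stalk x') (χ (chartGen (minGenerators (X.presheaf.stalk (π.base x'))) j i))) ∈
      localRidge (X.presheaf.stalk (π.base x')) (ResidueField (X'.presheaf.stalk x')) := by
  classical
  letI algκ : Algebra (ResidueField (X.presheaf.stalk (π.base x'))) (ResidueField (X'.presheaf.stalk x')) :=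
    (ResidueField.map (π.stalkMap x').hom).toAlgebra
  letI algCO : Algebra (chartRing (minGenerators (X.presheaf.stalk (π.base x'))) j) (X'.presheaf.stalk x') :=
    χ.toAlgebra
  letI algRO : Algebra (X.presheaf.stalk (π.base x')) (X'.presheaf.stalk x') := (π.stalkMap x').hom.toAlgebra
  haveI : IsLocalization.AtPrime (X'.presheaf.stalk x') 𝔴.asIdeal := hloc
  have hx : Ideal.span (Set.range (minGenerators (X.presheaf.stalk (π.base x')))) = maximalIdeal (X.presheaf.stalk (π.base x')) := span_range_minGenerators _
  -- permissibility of `𝔪_x = (x)`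
  have hp : (Ideal.span (Set.range (minGenerators (X.presheaf.stalk (π.base x'))))).IsPermissible := by rw [hx, ← hD]; exact hperm
  haveI : IsRegularLocalRing (X.presheaf.stalk (π.base x') ⧸ Ideal.span (Set.range (minGenerators (X.presheaf.stalk (π.base x'))))) := hp.1
  haveI : IsDomain (X.presheaf.stalk (π.base x') ⧸ Ideal.span (Set.range (minGenerators (X.presheaf.stalk (π.base x'))))) := isDomain_of_isRegularLocalRing _
  haveI : (Ideal.span (Set.range (minGenerators (X.presheaf.stalk (π.base x'))))).IsPrime := (Ideal.Quotient.isDomain_iff_prime _).mp inferInstance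
  have hOO' : ∀ r : X.presheaf.stalk (π.base x'),
      algebraMap (X.presheaf.stalk (π.base x')) (X'.presheaf.stalk x') r =
        (algebraMap (chartRing (minGenerators (X.presheaf.stalk (π.base x'))) j) (X'.presheaf.stalk x') : chartRing (minGenerators (X.presheaf.stalk (π.base x'))) j →+* X'.presheaf.stalk x') (chartBase (minGenerators (X.presheaf.stalk (π.base x'))) j r) :=
    fun r => (hχ r).symm
  have hnear' : IsNearRing (X.presheaf.stalk (π.base x')) (X'.presheaf.stalk x') N := hnear
  let θ : chartRing (minGenerators (X.presheaf.stalk (π.base x'))) j →+* ResidueField (X'.presheaf.stalk x') := (residue (X'.presheaf.stalk x')).comp χ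
  have hθP : ∀ z ∈ 𝔴.asIdeal, θ z = 0 := fun z hz => by
    change residue (X'.presheaf.stalk x') (χ z) = 0
    rw [residue_eq_zero_iff]
    exact (IsLocalization.AtPrime.to_map_mem_maximal_iff (X'.presheaf.stalk x') 𝔴.asIdeal z).mpr hz
  have hθ : ∀ r : X.presheaf.stalk (π.base x'), θ (chartBase (minGenerators (X.presheaf.stalk (π.base x'))) j r) =
      algebraMap (ResidueField (X.presheaf.stalk (π.base x'))) (ResidueField (X'.presheaf.stalk x'))
        (residue (X.presheaf.stalk (π.base x')) r) := fun r => by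
    change residue (X'.presheaf.stalk x') (χ (chartBase (minGenerators (X.presheaf.stalk (π.base x'))) j r)) =
      ResidueField.map (π.stalkMap x').hom (residue (X.presheaf.stalk (π.base x')) r)
    rw [hχ, ResidueField.map_residue]
  obtain ⟨v, hv, hvL⟩ := ridgeConfinedAt_of_isNearRing_of_ringHom (minGenerators (X.presheaf.stalk (π.base x'))) j hUC hp.2.1 𝔴.asIdeal (X'.presheaf.stalk x')
    h𝔴 hOO' hnear' θ hθP hθ
  -- the degree-one initial form of `x_i` in the coordinates `x` is `X_i`, so `v = ū`
  have hvi : ∀ i, v i = θ (chartGen (minGenerators (X.presheaf.stalk (π.base x'))) j i) := fun i => by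
    have hXi : (MvPolynomial.X i : MvPolynomial _ (ResidueField (X.presheaf.stalk (π.base x')))) ∈
        initialFormsOf (minGenerators (X.presheaf.stalk (π.base x'))) (minGenerators (X.presheaf.stalk (π.base x')) i) 1 :=
      ⟨MvPolynomial.X i, isHomogeneous_X _ i, eval_X i, map_X _ i⟩
    have h := hvL i (MvPolynomial.X i) hXi
    rwa [aeval_X] at h
  have hveq : v = fun i => θ (chartGen (minGenerators (X.presheaf.stalk (π.base x'))) j i) := funext hvi
  rw [hveq] at hv
  exact hv

-- (`maxHeartbeats`: the stalks of a scheme carry their ring structure through `CommRingCat`; matching the instance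
-- paths of `κ(x) → κ(x')` produced here against those inside `IsOnProjDirectrix` is correct but slow)
set_option maxHeartbeats 800000 in
omit [IsLocallyNoetherian X'] in
/-- **Near points of the blow-up of a point with PERFECT residue field lie on the projectivised directrix.** Same
setting; if `κ(x)` is perfect then `IsOnProjDirectrix π x'` (CJS Def. 6.34: every linear form of the directrix space of
`C_x(X)`, lifted to `𝔪_x`, maps into `𝔪_x𝒪_{X',x'} · 𝔪_{x'}`). Ridge confinement + Dietel (6.3.5) (ii)
(`Dietel2015_ridge_perfect_holds`: `√𝔉 = 𝒯·S` over a perfect field). [cite: CossartJannsenSaito2020, Thm. 3.14]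
[cite: Dietel2015, Lemma (6.3.5) (ii) p. 76] -/
theorem isOnProjDirectrix_of_isNearPoint_of_perfectField (hπ : IsBlowup π D) (x' : X')
    (hperm : IdealSheafData.IsPermissibleAt D (π.base x'))
    (hUC : IsUniversallyCatenaryRing (X.presheaf.stalk (π.base x')))
    (hD : stalkIdeal D (π.base x') = maximalIdeal (X.presheaf.stalk (π.base x')))
    (hperf : PerfectField (ResidueField (X.presheaf.stalk (π.base x'))))
    {N : ℕ} (hnear : IsNearPoint π N x') : IsOnProjDirectrix π x' := by
  classical
  intro L hL c hc
  letI algκ : Algebra (ResidueField (X.presheaf.stalk (π.base x'))) (ResidueField (X'.presheaf.stalk x')) :=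
    (ResidueField.map (π.stalkMap x').hom).toAlgebra
  have hx : Ideal.span (Set.range (minGenerators (X.presheaf.stalk (π.base x')))) = maximalIdeal (X.presheaf.stalk (π.base x')) := span_range_minGenerators _
  -- a chart through `x'` for the generators `x` of `𝓘_{D,x} = 𝔪_x`
  obtain ⟨j, 𝔴, χ, hχ, hloc, h𝔴⟩ := hπ.exists_reesChart_stalk x' (minGenerators (X.presheaf.stalk (π.base x'))) (hx.trans hD.symm)
  letI algCO : Algebra (chartRing (minGenerators (X.presheaf.stalk (π.base x'))) j) (X'.presheaf.stalk x') := χ.toAlgebra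
  haveI : IsLocalization.AtPrime (X'.presheaf.stalk x') 𝔴.asIdeal := hloc
  have hū := mem_localRidge_of_isNearPoint_point x' hperm hUC hD hnear j 𝔴 χ hχ hloc h𝔴
  -- over the perfect `κ(x)`: `√𝔉 = 𝒯 · S`, so `L(ū) = 0`
  have hJ : IsHomogeneousIdeal (canonicalTangentConeIdeal (X.presheaf.stalk (π.base x'))) := isHomogeneousIdeal_tangentConeIdeal _ _
  have h56 := (Dietel2015_ridge_perfect_holds (ResidueField (X.presheaf.stalk (π.base x'))) _ (canonicalTangentConeIdeal (X.presheaf.stalk (π.base x'))) hJ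
    (ResidueField (X.presheaf.stalk (π.base x'))) hperf).1
  have hcone : coneIdeal (ResidueField (X.presheaf.stalk (π.base x'))) (canonicalTangentConeIdeal (X.presheaf.stalk (π.base x'))) = canonicalTangentConeIdeal (X.presheaf.stalk (π.base x')) := by
    have hid : (MvPolynomial.map (RingHom.id (ResidueField (X.presheaf.stalk (π.base x')))) :
        MvPolynomial (Fin (maximalIdeal (X.presheaf.stalk (π.base x'))).spanFinrank)
          (ResidueField (X.presheaf.stalk (π.base x'))) →+* _) = RingHom.id _ :=
      RingHom.ext fun p => MvPolynomial.map_id p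
    rw [coneIdeal, Algebra.algebraMap_self, hid, Ideal.map_id]
  rw [hcone] at h56
  have hLrad : L ∈ (ridgeIdeal (canonicalTangentConeIdeal (X.presheaf.stalk (π.base x')))).radical := by
    rw [h56]; exact Ideal.subset_span hL
  have hLū := aeval_eq_zero_of_mem_ridge_of_mem_radical ((mem_localRidge_iff _).mp hū) hLrad
  -- `L = Σ_i (coeff_i L) X_i`
  obtain ⟨w, hwL⟩ : ∃ w, linForm w = L := by
    have h1 : L ∈ LinearMap.range (linForm (K := ResidueField (X.presheaf.stalk (π.base x')))
        (n := (maximalIdeal (X.presheaf.stalk (π.base x'))).spanFinrank)) := by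
      rw [range_linForm]; exact directrixSpace_le_one _ hL
    exact LinearMap.mem_range.mp h1
  have hcoeff : ∀ i, MvPolynomial.coeff (Finsupp.single i 1) L = w i := fun i => by
    rw [← hwL, linForm_apply, coeff_sum, Finset.sum_eq_single i]
    · rw [coeff_smul, coeff_X, if_pos rfl, smul_eq_mul, mul_one]
    · intro b _ hb
      rw [coeff_smul, coeff_X, if_neg (fun h => hb (Finsupp.single_left_injective one_ne_zero h)), smul_zero]
    · exact fun h => (h (Finset.mem_univ i)).elim
  -- `π♯(x_i) = χ(e_i) · π♯(x_j)`, `π♯(x_j) ∈ 𝔪_x 𝒪'`, and `Σ_i c̄_i ū_i = L(ū) = 0`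
  have hcl : ∀ i, (π.stalkMap x').hom (minGenerators (X.presheaf.stalk (π.base x')) i) =
      χ (chartGen (minGenerators (X.presheaf.stalk (π.base x'))) j i) * (π.stalkMap x').hom (minGenerators (X.presheaf.stalk (π.base x')) j) := fun i => by
    rw [← hχ, ← hχ, reesChartBase_apply_eq_mul_chartGen (minGenerators (X.presheaf.stalk (π.base x'))) j i, map_mul, mul_comm]
  have ht : (π.stalkMap x').hom (minGenerators (X.presheaf.stalk (π.base x')) j) ∈
      (maximalIdeal (X.presheaf.stalk (π.base x'))).map (π.stalkMap x').hom :=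
    Ideal.mem_map_of_mem _ (by rw [← hx]; exact Ideal.subset_span ⟨j, rfl⟩)
  have hL' : aeval (fun i => residue (X'.presheaf.stalk x') (χ (chartGen (minGenerators (X.presheaf.stalk (π.base x'))) j i))) (linForm w) = 0 :=
    hwL ▸ hLū
  have h0 := (aeval_linForm_eq_sum w _).symm.trans hL'
  exact map_sum_mul_mem_of_residue_sum_eq_zero (π.stalkMap x').hom (minGenerators (X.presheaf.stalk (π.base x'))) c
    (fun i => χ (chartGen (minGenerators (X.presheaf.stalk (π.base x'))) j i)) _ hcl ht w (fun i => (hc i).trans (hcoeff i)) h0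

end Point

/-! ## The door's shape: blow-up of a closed point of an excellent scheme -/

section Door

variable {X X' : Scheme.{u}} [IsLocallyNoetherian X] {π : X' ⟶ X} {x : X}

/-- **W-top / CJS-3.14 confinement at a PERFECT closed point, unconditional.** `X` excellent and locally noetherian,
`x` a closed point with `0 < dim 𝒪_{X,x}` and PERFECT residue field, `π : X' → X` the blow-up in `{x}`, `x'` a point over
`x` NEAR at level `N` (`H^N_{X'}(x') = H^N_X(x)`, `Scheme.hsFun`): then `IsOnProjDirectrix π x'`. Compare
`isOnProjDirectrix_of_near_top` (modulo F-58♭, `NearAlignment`, `dim X ≤ 5 ∨ …`, `char > 0`, `ē`-bookkeeping): none of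
these is needed when `κ(x)` is perfect. [cite: CossartJannsenSaito2020, Thm. 3.14] [cite: Dietel2015, Lemma (6.3.5) (ii) p. 76] -/
theorem isOnProjDirectrix_of_near_of_perfectField (hX : Scheme.IsExcellent X) (hx : IsClosed ({x} : Set X))
    (hπ : IsBlowup π (Scheme.IdealSheafData.vanishingIdeal ⟨{x}, hx⟩))
    (hpos : 0 < ringKrullDim (X.presheaf.stalk x)) (hperf : PerfectField (ResidueField (X.presheaf.stalk x)))
    {N : ℕ} {x' : X'} (hxx' : π.base x' = x) (hnear : Scheme.hsFun X' N x' = Scheme.hsFun X N x) :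
    IsOnProjDirectrix π x' := by
  subst hxx'
  have hperm : IdealSheafData.IsPermissibleAt (Scheme.IdealSheafData.vanishingIdeal ⟨{π.base x'}, hx⟩) (π.base x') := by
    rw [IdealSheafData.isPermissibleAt_iff, stalkIdeal_vanishingIdeal_singleton hx]
    exact (isPermissible_maximalIdeal_iff _).mpr fun hmin => by
      have h0 : (maximalIdeal (X.presheaf.stalk (π.base x'))).height = 0 := Ideal.height_eq_zero_iff.mpr hmin
      have hdim : ringKrullDim (X.presheaf.stalk (π.base x')) = 0 := by
        rw [← IsLocalRing.maximalIdeal_height_eq_ringKrullDim, h0]; rfl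
      rw [hdim] at hpos
      exact lt_irrefl _ hpos
  exact isOnProjDirectrix_of_isNearPoint_of_perfectField hπ x' hperm (hX.isUniversallyCatenaryRing_stalk _)
    (stalkIdeal_vanishingIdeal_singleton hx) hperf (N := N) hnear

end Door

end CampaignW42

end Summit.ResolutionOfSingularities.ResolutionOfSingularities.Theorems

end
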